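import Summits.NavierStokesRegularity.NavierStokesRegularity.Theorems.TypeICertificateLadderTargetRotatingConjugateDensitySmooth
import Summits.NavierStokesRegularity.NavierStokesRegularity.Theorems.TypeICertificateLadderTargetRotatingConjugateDensityKato
import HarnessLib

/-!
# Positivity of the smooth solution of the twisted weight equation
# (tools for the rotating conjugate density, stub B2 of line `killing-twisted-bernoulli-solitons`,
# crux `Target`, stmt-NavierStokesRegularity-1217)

Helper file (all results proved, no definitions, no named facts). Rotating-gauge version of the
second half of step `F5` of the tree's `PineauVicolWeightPositivity` (Pineau–Vicol 2026,
Prop. 5.1 / Lemma 5.5, arXiv:2607.09619), drift `X₀ = ½y + (U − J)` with `DriftHyp U C₀` and `J`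
skew linear: the positive part `v⁺ = (|v| + v)/2` of a smooth finite-energy solution of `N v = 0`
is again a distributional, hence smooth classical, solution (`posPart_contDiff_rot`, from the
Kato step `integral_gaussWeight_mul_abs_transpose_eq_zero_rot` and hypoellipticity
`exists_contDiff_ae_eq_rot`); by Hopf's strong minimum principle
(`Literature.Analysis.PDE.hopf_minimumPrinciple`, locally bounded coefficients only) a
nonnegative solution vanishing somewhere vanishes identically
(`eq_zero_of_nonneg_of_apply_eq_zero_rot`), so `v` has a strict sign (`pos_or_nonpos_rot`) and
the smooth solution of `exists_smooth_solution_rot` may be taken positive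
(`exists_pos_solution_rot`; registered `ℝ³` form `rotatingDensity_posSolution`, `J = α rotGen`).

References: B. Pineau, V. Vicol, arXiv:2607.09619 (2026), Prop. 5.1, Lemma 5.5;
J. López-Gómez, *Linear second order elliptic operators* (2013), Thm. 1.2 (Hopf).
-/

noncomputable section

open MeasureTheory TopologicalSpace Set Function Filter Topology InnerProductSpace Real
open scoped RealInnerProductSpace ENNReal NNReal ContDiff Distributions

namespace Summit.NavierStokesRegularity.NavierStokesRegularity.Theorems

open Literature.Analysis.FluidPDE Literature.Analysis.FluidPDE.PineauVicol2026
open scoped Laplacian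

section General

variable {E : Type} [NormedAddCommGroup E] [InnerProductSpace ℝ E] [FiniteDimensional ℝ E]
  [MeasurableSpace E] [BorelSpace E]

variable {U : E → E} {C₀ : ℝ}

/-- **The positive part `v⁺` is smooth and is again a classical solution, rotating gauge**
(`γ v⁺` solves the equation distributionally, hence is smooth by hypoellipticity; continuity
upgrades a.e. to everywhere). [folklore] -/
theorem posPart_contDiff_rot (h : DriftHyp U C₀) {J : E →L[ℝ] E} (hJ : ∀ v, ⟪J v, v⟫ = 0) {v : E → ℝ}
    (hv : ContDiff ℝ ∞ v) (hv2 : MemLp v 2 (gaussMeasure (E := E))) (hG2 : MemLp (gradient v) 2 (gaussMeasure (E := E)))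
    (hH : Integrable (fun y => gaussWeight y * (‖y‖ ^ 2 * v y ^ 2)))
    (hN : ∀ y, adjN (fun z : E => (1 / 2 : ℝ) • z + (U z - J z)) v y = 0) :
    ContDiff ℝ ∞ (fun y => max (v y) 0) ∧
      ∀ y, adjN (fun z : E => (1 / 2 : ℝ) • z + (U z - J z)) (fun y => max (v y) 0) y = 0 := by
  set X₀ : E → E := fun z => (1 / 2 : ℝ) • z + (U z - J z) with hX₀
  have hXs : ContDiff ℝ ∞ X₀ := (contDiff_id.const_smul (1 / 2 : ℝ)).add (h.contDiff.sub J.contDiff)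
  have hX₀1 : ContDiff ℝ 1 X₀ := hXs.of_le (mod_cast le_top)
  have hX₀' : ∀ y, (1 / 2 : ℝ) • y + U y - J y = X₀ y := fun y => add_sub_assoc _ _ _
  have hγv2 : ContDiff ℝ 2 (fun z => gaussWeight z * v z) := contDiff_gaussWeight.mul (hv.of_le (by norm_cast))
  have hγv : Integrable (fun y => gaussWeight y * v y) := integrable_gaussWeight_mul_of_memLp hv2
  -- the distributional equation for `γ v⁺`
  have hdist : ∀ φ : E → ℝ, ContDiff ℝ ∞ φ → HasCompactSupport φ →
      ∫ y, (gaussWeight y * max (v y) 0) * ((Δ φ) y - fderiv ℝ φ y (X₀ y)) = 0 := by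
    intro φ hφ hφc
    have habs := integral_gaussWeight_mul_abs_transpose_eq_zero_rot h hJ hv hv2 hG2 hH hN hφ hφc
    have hlin : ∫ y, (gaussWeight y * v y) * ((Δ φ) y - fderiv ℝ φ y (X₀ y)) = 0 := by
      rw [integral_mul_transpose_eq (X₀ := X₀) hγv2 hX₀1 hφ hφc]
      have : ∀ y, ((Δ (fun z => gaussWeight z * v z)) y +
          VectorCalculus.divergence (fun z => (gaussWeight z * v z) • X₀ z) y) * φ y = 0 := fun y => by
        have := hN y
        unfold adjN at this
        rw [this, zero_mul]
      simp [this]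
    -- bounded multiplier
    set g : E → ℝ := fun y => (Δ φ) y - fderiv ℝ φ y (X₀ y) with hg
    have hφ2 : ContDiff ℝ 2 φ := hφ.of_le (by norm_cast)
    have hgc : Continuous g := (continuous_laplacian hφ2).sub
      ((hφ.continuous_fderiv (by simp)).clm_apply hXs.continuous)
    have hgs : HasCompactSupport g := by
      refine hasCompactSupport_of_eq_zero hφc fun y hy => ?_
      simp only [hg, laplacian_eq_zero_of_notMem_tsupport hy, fderiv_of_notMem_tsupport ℝ hy, zero_apply, sub_zero]
    obtain ⟨K, hK⟩ := exists_bound_of_hasCompactSupport hgc hgs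
    have i1 : Integrable (fun y => gaussWeight y * |v y| * g y) := by
      have : Integrable (fun y => |gaussWeight y * v y| * g y) := hγv.abs.mul_bdd hgc.aestronglyMeasurable
        (Eventually.of_forall hK)
      refine this.congr (Eventually.of_forall fun y => ?_)
      dsimp only
      rw [abs_mul, abs_of_pos (gaussWeight_pos y)]
    have i2 : Integrable (fun y => gaussWeight y * v y * g y) := hγv.mul_bdd hgc.aestronglyMeasurable (Eventually.of_forall hK)
    have e : ∫ y, (gaussWeight y * max (v y) 0) * g y =
        ∫ y, (1 / 2 : ℝ) * (gaussWeight y * |v y| * g y + gaussWeight y * v y * g y) := by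
      refine integral_congr_ae (Eventually.of_forall fun y => ?_)
      dsimp only
      rw [max_zero_eq_half]; ring
    rw [e, integral_const_mul, integral_add i1 i2, habs, hlin]
    simp
  have hcont : Continuous fun y => gaussWeight y * max (v y) 0 :=
    continuous_gaussWeight.mul (hv.continuous.max continuous_const)
  have hdist' : ∀ φ : E → ℝ, ContDiff ℝ ∞ φ → HasCompactSupport φ →
      ∫ y, (gaussWeight y * max (v y) 0) * ((Δ φ) y - fderiv ℝ φ y ((1 / 2 : ℝ) • y + U y - J y)) = 0 := by
    simp only [hX₀']
    exact hdist
  obtain ⟨w, hw, hae⟩ := exists_contDiff_ae_eq_rot h J hcont.locallyIntegrable hdist'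
  have heq : (fun y => gaussWeight y * max (v y) 0) = w := (hcont.ae_eq_iff_eq volume hw.continuous).1 hae
  have hsmooth : ContDiff ℝ ∞ (fun y => max (v y) 0) := by
    have e : (fun y => max (v y) 0) = fun y => w y / gaussWeight y := by
      funext y
      have := congrFun heq y
      rw [← this]
      field_simp [(gaussWeight_pos y).ne']
    rw [e]
    exact hw.div contDiff_gaussWeight fun y => (gaussWeight_pos y).ne'
  have hdistw : ∀ φ : E → ℝ, ContDiff ℝ ∞ φ → HasCompactSupport φ →
      ∫ y, w y * ((Δ φ) y - fderiv ℝ φ y (X₀ y)) = 0 := by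
    intro φ hφ hφc
    rw [← heq]
    exact hdist φ hφ hφc
  have hcl := laplacian_add_divergence_eq_zero_of_distributional hw hXs hdistw
  refine ⟨hsmooth, fun y => ?_⟩
  unfold adjN
  have e1 := hcl y
  rw [← heq] at e1
  exact e1

end General

/-! ### Hopf's minimum principle on Euclidean space: the dichotomy and the positive solution -/

section Euclidean

variable {n : ℕ} {U : EuclideanSpace ℝ (Fin n) → EuclideanSpace ℝ (Fin n)} {C₀ : ℝ}

/-- **Hopf's strong minimum principle for nonnegative classical solutions of `N p = 0`, rotating
gauge** (`E = ℝⁿ`, drift `½y + (U − J)`): a smooth `p ≥ 0` with `N p = 0` vanishing at one point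
vanishes identically (the tree's `Literature.Analysis.PDE.hopf_minimumPrinciple` for
`𝔏 = −Δ + (½y − U + J)·∇ + (½⟪U,y⟫)⁺`; coefficients bounded on compact sets). [cite: PineauVicol2026, proof of Lemma 5.5 (strict positivity via [27, Thm. 3.5])] -/
theorem eq_zero_of_nonneg_of_apply_eq_zero_rot (h : DriftHyp U C₀)
    {J : EuclideanSpace ℝ (Fin n) →L[ℝ] EuclideanSpace ℝ (Fin n)} (hJ : ∀ v, ⟪J v, v⟫ = 0)
    {p : EuclideanSpace ℝ (Fin n) → ℝ} (hp : ContDiff ℝ ∞ p) (hp0 : ∀ y, 0 ≤ p y)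
    (hNp : ∀ y, adjN (fun z : EuclideanSpace ℝ (Fin n) => (1 / 2 : ℝ) • z + (U z - J z)) p y = 0)
    {x₀ : EuclideanSpace ℝ (Fin n)} (hx₀ : p x₀ = 0) : ∀ x, p x = 0 := by
  classical
  have hp2 : ContDiff ℝ 2 p := hp.of_le (by norm_cast)
  have hU'1 : ContDiff ℝ 1 (fun z : EuclideanSpace ℝ (Fin n) => U z - J z) := (h.contDiff.sub J.contDiff).of_le (mod_cast le_top)
  set bvec : EuclideanSpace ℝ (Fin n) → EuclideanSpace ℝ (Fin n) := fun x => (1 / 2 : ℝ) • x - (U x - J x) with hbvec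
  have hbc : Continuous bvec := (continuous_id.const_smul (1 / 2 : ℝ)).sub (h.continuous.sub J.continuous)
  set cfun : EuclideanSpace ℝ (Fin n) → ℝ := fun x => ⟪U x, x⟫ / 2 with hcfun
  have hcc : Continuous cfun := (h.continuous.inner continuous_id).div_const 2
  -- the pointwise equation `−Δp + Dp[bvec] + c p = 0`
  have hMp : ∀ x, -(Δ p) x + fderiv ℝ p x (bvec x) + cfun x * p x = 0 := by
    intro x
    have e := hNp x
    rw [adjN_eq_neg_mul hp2 hU'1 x, divergence_sub_skew_eq_zero h hJ x, sub_zero, inner_sub_skew_eq U hJ x,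
      neg_eq_zero] at e
    rcases mul_eq_zero.1 e with h0 | h0
    · exact absurd h0 (gaussWeight_pos x).ne'
    · exact h0
  have key := Literature.Analysis.PDE.hopf_minimumPrinciple (N := n) (Ω := Set.univ) isOpen_univ isPreconnected_univ
    (a := fun _ i j => if i = j then (1 : ℝ) else 0) (b := fun x i => bvec x i) (c := fun x => max (cfun x) 0)
    (u := p) (μ := 1) (m := 0)
    (fun _ _ i j => by by_cases hij : i = j <;> simp [hij, eq_comm]) one_pos
    (fun x _ ξ => by
      rw [one_mul, EuclideanSpace.real_norm_sq_eq]
      refine le_of_eq (Finset.sum_congr rfl fun i _ => ?_)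
      simp only [ite_mul, one_mul, zero_mul, Finset.sum_ite_eq, Finset.mem_univ, if_true, sq])
    ?_ (fun x _ => le_max_right _ _) hp2.contDiffOn ?_ le_rfl (fun x _ => hp0 x) (Set.mem_univ x₀) hx₀
  · exact fun x => key x (Set.mem_univ x)
  · -- bounded coefficients on compact sets
    intro K _ hK
    obtain ⟨Cb, hCb⟩ := hK.exists_bound_of_continuousOn hbc.continuousOn
    obtain ⟨Cc, hCc⟩ := hK.exists_bound_of_continuousOn hcc.continuousOn
    refine ⟨max 1 (max Cb Cc), fun x hx => ⟨fun i j => ?_, fun i => ?_, ?_⟩⟩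
    · by_cases hij : i = j <;> simp [hij]
    · calc |bvec x i| ≤ ‖bvec x‖ := by rw [← Real.norm_eq_abs]; exact PiLp.norm_apply_le (bvec x) i
        _ ≤ Cb := hCb x hx
        _ ≤ max 1 (max Cb Cc) := (le_max_left _ _).trans (le_max_right _ _)
    · have h1 : |max (cfun x) 0| ≤ |cfun x| := by
        rw [abs_of_nonneg (le_max_right _ _)]
        exact max_le (le_abs_self _) (abs_nonneg _)
      calc |max (cfun x) 0| ≤ |cfun x| := h1
        _ = ‖cfun x‖ := (Real.norm_eq_abs _).symm
        _ ≤ Cc := hCc x hx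
        _ ≤ max 1 (max Cb Cc) := (le_max_right _ _).trans (le_max_right _ _)
  · -- `𝔏p ≥ 0`
    intro x _
    have hsum2 : ∑ i, ∑ j, (if i = j then (1 : ℝ) else 0) *
        fderiv ℝ (fderiv ℝ p) x (EuclideanSpace.single i 1) (EuclideanSpace.single j 1) = (Δ p) x := by
      rw [← sum_fderiv_fderiv_single_eq_laplacian hp2 x]
      refine Finset.sum_congr rfl fun i _ => ?_
      simp only [ite_mul, one_mul, zero_mul, Finset.sum_ite_eq, Finset.mem_univ, if_true]
    rw [hsum2, sum_mul_fderiv_single]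
    have := hMp x
    have hc : 0 ≤ (max (cfun x) 0 - cfun x) * p x := mul_nonneg (by linarith [le_max_left (cfun x) 0]) (hp0 x)
    nlinarith

/-- **Dichotomy, rotating gauge**: a smooth finite-energy solution of `N v = 0` (with `γ|y|²v²`
integrable) is either everywhere positive or everywhere `≤ 0`. [folklore] -/
theorem pos_or_nonpos_rot (h : DriftHyp U C₀)
    {J : EuclideanSpace ℝ (Fin n) →L[ℝ] EuclideanSpace ℝ (Fin n)} (hJ : ∀ v, ⟪J v, v⟫ = 0)
    {v : EuclideanSpace ℝ (Fin n) → ℝ} (hv : ContDiff ℝ ∞ v)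
    (hv2 : MemLp v 2 (gaussMeasure (E := EuclideanSpace ℝ (Fin n))))
    (hG2 : MemLp (gradient v) 2 (gaussMeasure (E := EuclideanSpace ℝ (Fin n))))
    (hH : Integrable (fun y => gaussWeight y * (‖y‖ ^ 2 * v y ^ 2)))
    (hN : ∀ y, adjN (fun z : EuclideanSpace ℝ (Fin n) => (1 / 2 : ℝ) • z + (U z - J z)) v y = 0) :
    (∀ y, 0 < v y) ∨ (∀ y, v y ≤ 0) := by
  by_cases hex : ∃ x₀, v x₀ ≤ 0
  · right
    obtain ⟨x₀, hx₀⟩ := hex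
    obtain ⟨hps, hNp⟩ := posPart_contDiff_rot h hJ hv hv2 hG2 hH hN
    have hzero := eq_zero_of_nonneg_of_apply_eq_zero_rot h hJ hps (fun y => le_max_right _ _) hNp (x₀ := x₀)
      (max_eq_right hx₀)
    intro y
    exact max_eq_right_iff.1 (hzero y)
  · left
    push Not at hex
    exact hex

/-- **Existence of a positive weight, rotating gauge** (Pineau–Vicol 2026, Prop. 5.1 in the
rotating frame: existence and strict positivity of `w = γ v` with
`Δw + div(w(U + ½y − Jy)) = 0`, on `ℝⁿ`): there is `v ∈ C^∞(ℝⁿ)`, `v > 0` everywhere,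
`v, ∇v ∈ L²(γ)`, `γ|y|²v²` integrable, with `N v = 0` for the drift `½y + (U − J)`. [cite: PineauVicol2026, Prop. 5.1 ((5.2), w > 0)] -/
theorem exists_pos_solution_rot (h : DriftHyp U C₀)
    {J : EuclideanSpace ℝ (Fin n) →L[ℝ] EuclideanSpace ℝ (Fin n)} (hJ : ∀ v, ⟪J v, v⟫ = 0) :
    ∃ v : EuclideanSpace ℝ (Fin n) → ℝ, ContDiff ℝ ∞ v ∧
      MemLp v 2 (gaussMeasure (E := EuclideanSpace ℝ (Fin n))) ∧
      MemLp (gradient v) 2 (gaussMeasure (E := EuclideanSpace ℝ (Fin n))) ∧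
      Integrable (fun y => gaussWeight y * (‖y‖ ^ 2 * v y ^ 2)) ∧ (∀ y, 0 < v y) ∧
      ∀ y, adjN (fun z : EuclideanSpace ℝ (Fin n) => (1 / 2 : ℝ) • z + (U z - J z)) v y = 0 := by
  obtain ⟨v, hv, hv2, hG2, hH, ⟨y₀, hy₀⟩, hN⟩ := exists_smooth_solution_rot h hJ
  have hN' : ∀ y, adjN (fun z : EuclideanSpace ℝ (Fin n) => (1 / 2 : ℝ) • z + (U z - J z)) v y = 0 := by
    intro y
    unfold adjN
    have e : (fun z : EuclideanSpace ℝ (Fin n) => (gaussWeight z * v z) • ((1 / 2 : ℝ) • z + (U z - J z))) =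
        fun z => (gaussWeight z * v z) • ((1 / 2 : ℝ) • z + U z - J z) := by
      funext z; rw [add_sub_assoc]
    rw [e]
    exact hN y
  rcases pos_or_nonpos_rot h hJ hv hv2 hG2 hH hN' with hpos | hnonpos
  · exact ⟨v, hv, hv2, hG2, hH, hpos, hN'⟩
  · have hX₀1 : ContDiff ℝ 1 (fun z : EuclideanSpace ℝ (Fin n) => (1 / 2 : ℝ) • z + (U z - J z)) :=
      (contDiff_id.const_smul (1 / 2 : ℝ)).add ((h.contDiff.sub J.contDiff).of_le (mod_cast le_top))
    have hnv : ContDiff ℝ ∞ (fun y => -v y) := hv.neg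
    have hnv2 : MemLp (fun y => -v y) 2 (gaussMeasure (E := EuclideanSpace ℝ (Fin n))) := hv2.neg
    have hnG2 : MemLp (gradient fun y => -v y) 2 (gaussMeasure (E := EuclideanSpace ℝ (Fin n))) := by
      rw [gradient_fun_neg']; exact hG2.neg
    have hnH : Integrable (fun y => gaussWeight y * (‖y‖ ^ 2 * (-v y) ^ 2)) := by
      refine hH.congr (Eventually.of_forall fun y => ?_); simp only [neg_sq]
    have hNn : ∀ y, adjN (fun z : EuclideanSpace ℝ (Fin n) => (1 / 2 : ℝ) • z + (U z - J z)) (fun y => -v y) y = 0 :=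
      fun y => by rw [adjN_neg (hv.of_le (by norm_cast)) hX₀1, hN' y, neg_zero]
    rcases pos_or_nonpos_rot h hJ hnv hnv2 hnG2 hnH hNn with hpos' | hnonpos'
    · exact ⟨fun y => -v y, hnv, hnv2, hnG2, hnH, hpos', hNn⟩
    · exfalso
      have h1 := hnonpos y₀
      have h2 := hnonpos' y₀
      exact hy₀ (by linarith)

end Euclidean

/-- **Registered form (B2 tool stub `rotatingDensity_posSolution`, `ℝ³`, `J = α • rotGenL`):** a
smooth positive `v` with `v, ∇v ∈ L²(γ)`, `γ|y|²v²` integrable, solving `N v = 0` for the drift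
`½y + (U − α rotGen)`. [cite: PineauVicol2026, Prop. 5.1 ((5.2), w > 0)] -/
theorem rotatingDensity_posSolution :
    ∀ (U : EuclideanSpace ℝ (Fin 3) → EuclideanSpace ℝ (Fin 3)) (C₀ α : ℝ), Literature.Analysis.FluidPDE.PineauVicol2026.DriftHyp U C₀ → ∃ v : EuclideanSpace ℝ (Fin 3) → ℝ, ContDiff ℝ (⊤ : ℕ∞) v ∧ MeasureTheory.MemLp v 2 (Literature.Analysis.FluidPDE.PineauVicol2026.gaussMeasure (E := EuclideanSpace ℝ (Fin 3))) ∧ MeasureTheory.MemLp (gradient v) 2 (Literature.Analysis.FluidPDE.PineauVicol2026.gaussMeasure (E := EuclideanSpace ℝ (Fin 3))) ∧ MeasureTheory.Integrable (fun y => Literature.Analysis.FluidPDE.PineauVicol2026.gaussWeight y * (‖y‖ ^ 2 * v y ^ 2)) ∧ (∀ y, 0 < v y) ∧ ∀ y : EuclideanSpace ℝ (Fin 3), Literature.Analysis.FluidPDE.PineauVicol2026.adjN (fun z => (1 / 2 : ℝ) • z + (U z - α • Literature.Analysis.FluidPDE.rotGen z)) v y = 0 := by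
  intro U C₀ α h
  have hJ : ∀ w : EuclideanSpace ℝ (Fin 3), ⟪(α • rotGenL) w, w⟫ = 0 := fun w => by
    rw [_root_.FunLike.coe_smul, Pi.smul_apply, rotGenL_apply, real_inner_smul_left, inner_rotGen_self, mul_zero]
  obtain ⟨v, hv, hv2, hG2, hH, hpos, hN⟩ := exists_pos_solution_rot h hJ
  exact ⟨v, hv, hv2, hG2, hH, hpos, hN⟩

end Summit.NavierStokesRegularity.NavierStokesRegularity.Theorems
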